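import Mathlib
import Literature.AlgebraicGeometry.Resolution.AlterationsLemma32
import Literature.AlgebraicGeometry.Resolution.RegularLocalRingsQuotient
import Literature.AlgebraicGeometry.Resolution.RegularLocalRingsJacobian
import HarnessLib

/-!
# A smooth scheme over a discrete valuation ring has good reduction everywhere

Stub `stub_goodAtOfSmooth` of the line `strata-split` for the crux `EquisingularLift`
(stmt-ResolutionOfSingularities-15660).

Let `O` be a discrete valuation ring and `q : P → Spec O` a smooth morphism. For every point
`y ∈ P`:

* the local ring `𝒪_{P,y}` is regular — `Spec O` is regular (a Dedekind domain is a regular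
  ring) and locally Noetherian, so EGA IV₄ 17.5.8 (iii) applies
  (`Literature.AlgebraicGeometry.Resolution.isRegularLocalRing_stalk_of_smooth`);
* for every uniformizer `ϖ` of `O`, the germ `g` at `y` of the global section `q♯(ϖ)` is not in
  `𝔪_y²`: either `g` is a unit, or `g ∈ 𝔪_y`, and then `O → 𝒪_{P,y}` is a flat local
  homomorphism, formally smooth and essentially of finite type, so that the closed fibre
  `𝒪_{P,y}/ϖ = k ⊗_O 𝒪_{P,y}` is a regular local ring (smooth over the residue field `k`,
  tree `isRegularLocalRing_of_formallySmooth_of_essFiniteType` of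
  `SmoothUniformizationProofs.lean`); as `ϖ` is `𝒪_{P,y}`-regular (flatness),
  `dim 𝒪_{P,y}/ϖ = dim 𝒪_{P,y} - 1`, and a regular quotient of a regular local ring by a
  non-zero element of `𝔪²` is impossible (Matsumura 14.2, tree
  `not_isRegularLocalRing_quotient_span_singleton_of_mem_sq` of `RegularLocalRingsJacobian.lean`).

References: A. Grothendieck, J. Dieudonné, *EGA IV₄*, Publ. Math. IHÉS 32 (1967), Prop. 17.5.8;
H. Matsumura, *Commutative Ring Theory*, CUP 1986, Thm. 14.2 and Thm. 23.7.
-/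

set_option linter.dupNamespace false -- mandated namespace of this single-conjunct summit
set_option linter.overlappingInstances false -- the registered signature carries both [IsDomain O] and [IsDiscreteValuationRing O] (Mathlib's class takes the former as a parameter)

namespace Summit.ResolutionOfSingularities.ResolutionOfSingularities.Cruxes.EquisingularLift.StrataSplit

open CategoryTheory AlgebraicGeometry TopologicalSpace
open IsLocalRing Literature.AlgebraicGeometry.Resolution
open scoped TensorProduct

universe u

/-- **A uniformizer stays outside `𝔪²` in a smooth local algebra.** Let `O` be a discrete
valuation ring with uniformizer `ϖ` and `S` a regular local `O`-algebra which is flat,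
formally smooth and essentially of finite type over `O`. If `ϖ ∈ 𝔪_S` then `ϖ ∉ 𝔪_S²`:
the closed fibre `S/ϖS = k ⊗_O S` is regular (formally smooth, essentially of finite type over
the residue field `k`), `ϖ ≠ 0` in `S` (flatness), and a regular local ring has no regular
quotient by a non-zero element of `𝔪²` (Matsumura, Thm. 14.2).
[cite: Matsumura1987, Thm. 14.2 and Thm. 23.7] -/
theorem algebraMap_notMem_maximalIdeal_sq (O : Type u) [CommRing O] [IsDomain O]
    [IsDiscreteValuationRing O] (S : Type u) [CommRing S] [IsRegularLocalRing S] [Algebra O S]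
    [Module.Flat O S] [Algebra.FormallySmooth O S] [Algebra.EssFiniteType O S]
    {ϖ : O} (hϖ : Irreducible ϖ) (hmem : algebraMap O S ϖ ∈ maximalIdeal S) :
    algebraMap O S ϖ ∉ (maximalIdeal S) ^ 2 := by
  have hmap : (maximalIdeal O).map (algebraMap O S) = Ideal.span {algebraMap O S ϖ} := by
    rw [hϖ.maximalIdeal_eq, Ideal.map_span, Set.image_singleton]
  -- `O → S` is a local homomorphism
  haveI : IsLocalHom (algebraMap O S) := by
    refine ((local_hom_TFAE (algebraMap O S)).out 0 2).mpr ?_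
    rw [hmap]
    exact (Ideal.span_singleton_le_iff_mem _).mpr hmem
  -- the closed fibre `k ⊗ S ≅ S/ϖS` is a regular local ring
  haveI : IsRegularLocalRing (ResidueField O ⊗[O] S) :=
    isRegularLocalRing_of_formallySmooth_of_essFiniteType (ResidueField O) _
  let eSp : ResidueField O ⊗[O] S ≃+* S ⧸ (maximalIdeal O).map (algebraMap O S) :=
    (Algebra.TensorProduct.comm O (ResidueField O) S).toRingEquiv.trans
      (Algebra.TensorProduct.quotIdealMapEquivTensorQuot S (maximalIdeal O)).toRingEquiv.symm
  haveI : IsRegularLocalRing (S ⧸ Ideal.span {algebraMap O S ϖ}) :=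
    IsRegularLocalRing.of_ringEquiv (eSp.trans (Ideal.quotEquivOfEq hmap))
  -- `ϖ ≠ 0` in the flat `O`-algebra `S`
  have hx0 : algebraMap O S ϖ ≠ 0 := by
    intro h
    have hreg : IsSMulRegular S ϖ :=
      Module.Flat.isSMulRegular_of_nonZeroDivisors (mem_nonZeroDivisors_of_ne_zero hϖ.ne_zero)
    have h1 : ϖ • (1 : S) = ϖ • (0 : S) := by rw [Algebra.smul_def, h, zero_mul, smul_zero]
    exact one_ne_zero (hreg h1)
  exact fun h2 => not_isRegularLocalRing_quotient_span_singleton_of_mem_sq hx0 h2 ‹_›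

/-- The germ at `y` of a global section pulled back along `q` is the germ at `y ∈ V` of its
image under `q.appLE ⊤ V : Γ(Y, ⊤) → Γ(P, V)`. -/
theorem appTop_comp_Γgerm {P Y : Scheme.{0}} (q : P ⟶ Y) {V : P.Opens} {y : P} (hyV : y ∈ V)
    (hVU : V ≤ q ⁻¹ᵁ ⊤) :
    q.appTop ≫ P.presheaf.Γgerm y = q.appLE ⊤ V hVU ≫ P.presheaf.germ V y hyV := by
  simp only [TopCat.Presheaf.Γgerm, Scheme.Hom.appLE, Category.assoc, TopCat.Presheaf.germ_res]
  rfl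

/-- **`stub_goodAtOfSmooth` (structural).** A smooth scheme `q : P → Spec O` over a discrete
valuation ring has good reduction everywhere in the sense of `Split.GoodAt` (unfolded): every
stalk `𝒪_{P,y}` is a regular local ring (EGA IV₄ 17.5.8 (iii), `Spec O` being regular), and for
every irreducible `ϖ : O` the germ at `y` of `q♯(ϖ)` is not in `𝔪_y²` — a unit at points of the
generic fibre, a regular parameter at points of the special fibre (there `𝒪_{P,y}/ϖ` is the local
ring of the smooth special fibre, regular of dimension `dim 𝒪_{P,y} - 1`).
[cite: Grothendieck1967, Prop. 17.5.8 (iii)] -/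
theorem stub_goodAtOfSmooth : ∀ (O : Type) [CommRing O] [IsDomain O] [IsDiscreteValuationRing O]
    (P : AlgebraicGeometry.Scheme.{0}) (q : P ⟶ AlgebraicGeometry.Spec (.of O)),
    AlgebraicGeometry.Smooth q → ∀ y : P,
    IsRegularLocalRing (P.presheaf.stalk y) ∧
      ∀ ϖ : O, Irreducible ϖ → (P.presheaf.Γgerm y).hom
        (q.appTop.hom ((AlgebraicGeometry.Scheme.ΓSpecIso (CommRingCat.of O)).inv.hom ϖ)) ∉
        (IsLocalRing.maximalIdeal (P.presheaf.stalk y)) ^ 2 := by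
  intro O _ _ _ P q hq y
  haveI := hq
  have hreg : IsRegularLocalRing (P.presheaf.stalk y) :=
    isRegularLocalRing_stalk_of_smooth q y (Scheme.isRegular_Spec (.of O) (q y))
  refine ⟨hreg, fun ϖ hϖ => ?_⟩
  -- an affine open neighbourhood `V` of `y`; `Γ(P, V)` is a smooth `O`-algebra
  obtain ⟨V, hV, hyV, hVU⟩ :=
    exists_isAffineOpen_mem_and_subset (X := P) (x := y) (U := q ⁻¹ᵁ ⊤) trivial
  have hsm : (q.appLE ⊤ V hVU).hom.Smooth := q.smooth_appLE (isAffineOpen_top _) hV hVU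
  have hφ : ((q.appLE ⊤ V hVU).hom.comp (Scheme.ΓSpecIso (.of O)).inv.hom).Smooth :=
    RingHom.Smooth.comp (RingHom.Smooth.of_bijective
      (Scheme.ΓSpecIso (.of O)).commRingCatIsoToRingEquiv.symm.bijective) hsm
  letI : Algebra O Γ(P, V) :=
    ((q.appLE ⊤ V hVU).hom.comp (Scheme.ΓSpecIso (.of O)).inv.hom).toAlgebra
  haveI : Algebra.Smooth O Γ(P, V) := hφ
  -- the stalk at `y` is the localization of `Γ(P, V)` at the prime `𝔭` of `y`
  letI : Algebra Γ(P, V) (P.presheaf.stalk y) :=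
    TopCat.Presheaf.algebra_section_stalk P.presheaf (U := V) ⟨y, hyV⟩
  haveI : IsLocalization.AtPrime (P.presheaf.stalk y) (hV.primeIdealOf ⟨y, hyV⟩).asIdeal :=
    hV.isLocalization_stalk ⟨y, hyV⟩
  let e : P.presheaf.stalk y ≃ₐ[Γ(P, V)]
      Localization.AtPrime (hV.primeIdealOf ⟨y, hyV⟩).asIdeal :=
    IsLocalization.algEquiv (hV.primeIdealOf ⟨y, hyV⟩).asIdeal.primeCompl _ _
  -- the germ of `q♯(ϖ)` corresponds to `algebraMap O S ϖ`, `S` the localization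
  have hgerm : e ((P.presheaf.Γgerm y).hom
      (q.appTop.hom ((Scheme.ΓSpecIso (CommRingCat.of O)).inv.hom ϖ))) =
      algebraMap O (Localization.AtPrime (hV.primeIdealOf ⟨y, hyV⟩).asIdeal) ϖ := by
    rw [← RingHom.comp_apply, ← CommRingCat.hom_comp, appTop_comp_Γgerm q hyV hVU,
      CommRingCat.hom_comp, RingHom.comp_apply]
    exact (e.commutes (algebraMap O Γ(P, V) ϖ)).trans (IsScalarTower.algebraMap_apply O
      Γ(P, V) (Localization.AtPrime (hV.primeIdealOf ⟨y, hyV⟩).asIdeal) ϖ).symm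
  -- transport along `e`
  rw [← Ideal.apply_mem_of_equiv_iff (f := e.toRingEquiv), Ideal.map_pow,
    map_ringEquiv_maximalIdeal]
  change e _ ∉ _
  rw [hgerm]
  haveI : IsRegularLocalRing (Localization.AtPrime (hV.primeIdealOf ⟨y, hyV⟩).asIdeal) :=
    IsRegularLocalRing.of_ringEquiv e.toRingEquiv
  by_cases hmem : algebraMap O (Localization.AtPrime (hV.primeIdealOf ⟨y, hyV⟩).asIdeal) ϖ ∈
      maximalIdeal (Localization.AtPrime (hV.primeIdealOf ⟨y, hyV⟩).asIdeal)
  · exact algebraMap_notMem_maximalIdeal_sq O _ hϖ hmem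
  · exact fun h => hmem (Ideal.pow_le_self two_ne_zero h)

end Summit.ResolutionOfSingularities.ResolutionOfSingularities.Cruxes.EquisingularLift.StrataSplit
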